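import Literature.AnabelianGeometry.AbsoluteAnabelian.FreeProlRankExtensionProofs
import Literature.AnabelianGeometry.AbsoluteAnabelian.ProfiniteElasticCriterionProofs
import Literature.AnabelianGeometry.AbsoluteAnabelian.AbsTopIThm26ivProofs
import HarnessLib

/-!
# `G_k` is elastic for `k/ℚ_p` finite ([AbsTopI] Thm 1.7 (ii)) — and [AbsTopI] Thm 2.6 (iv) made
# unconditional for extensions with MLF base (GAP row G-w5d206-1 closed)

S. Mochizuki, *Topics in Absolute Anabelian Geometry I: Generalities* (2012) [AbsTopI] (lit key
`paper:url-11ac98ba15fc`), Thm 1.7 (ii) p. 14: "If `k` is an MLF, then `G_k` [...] is elastic";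
Thm 2.6 (iv) p. 22 (proof p. 24: "follows immediately from the existence of a surjection `G ↠ Ẑ`
[Prop 1.5 (ii)], together with the elasticity of `G` [Thm 1.7 (ii)], and the topological finite
generation of `Δ` [Prop 2.2]").

THIS PROOF-ONLY FILE (no definitions, no named facts) assembles the abc-iut cell's discharge of
GAP-LEDGER row G-w5d206-1 (= the one named input `IsElastic E.gal` of abc-iut-w5-d206's
`thm26iv_of_isElastic_gal`, p414151):

* `freeProlRank_eq_of_isOpen_absoluteGaloisGroup` — every open `U ⊆ G_K` (`K/ℚ_p` finite) has
  `δ¹_p(U) = [K : ℚ_p] · [G_K : U] + 1` (`U = G_L` by infinite Galois theory, the landed rank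
  formula `thm26_ii_delta_gal_holds` at `L`, and `[L : K] = [G_K : U]`);
* `isElastic_absoluteGaloisGroup` — **`G_K` is ELASTIC**: abc-iut-L4-t15's criterion
  `isElastic_of_freeProlRank_open_eq` (file (2)) fed with the rank formula and abc-iut-w5-d206's
  key rank lemma `freeProlRank_le_add_of_sup_zpowers` (file (1));
* `IsElastic.of_continuousMulEquiv` — elasticity is invariant under isomorphisms of topological
  groups; hence `FundamentalExtension.MLFBase.isElastic_gal`: `G` is elastic for every abstract
  extension `1 → Δ → Π → G → 1` with MLF base data `G ≅ G_K`;
* `FundamentalExtension.MLFBase.thm26iv` / `MLFBase.preservesGeom` — [AbsTopI] Thm 2.6 (iv) for such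
  extensions GIVEN ONLY Prop 2.2 by name (`E.GeomTFG`) and the construction datum "`Δ` pro-`Σ`,
  `Σ ⊆ Primes`" — the elasticity input is now a theorem.

HONEST CAVEAT: the elasticity is obtained by an elementary rank argument over the landed rank formula
`δ¹_p(G_L) = [L : ℚ_p] + 1` (local class field theory, proved in the tree), NOT by the printed
route of [AbsTopI] Thm 1.7 (ii) (free pro-`p` structure of maximal pro-`p` quotients); it
discharges the tree's typed predicate `IsElastic`, which is what establishment means here.
Classical; nothing in this file bears on [IUTchIII] Cor. 3.12.
-/

noncomputable section

open Topology Field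

universe u v

namespace Literature.AnabelianGeometry.AbsoluteAnabelian

/-! ### The rank formula on open subgroups of `G_K` -/

/-- For `K/ℚ_p` finite and `U ⊆ G_K` open: `δ¹_p(U) = [K : ℚ_p] · [G_K : U] + 1` — `U = G_L` for the
finite subextension `L = K̄^U`, `δ¹_p(G_L) = [L : ℚ_p] + 1` (landed rank formula of Thm 2.6 (ii)),
and `[L : ℚ_p] = [K : ℚ_p] · [L : K] = [K : ℚ_p] · [G_K : U]` (fundamental theorem of infinite
Galois theory). [cite: MochizukiAbsTopI2012, Thm 2.6 (ii) p.21] -/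
theorem freeProlRank_eq_of_isOpen_absoluteGaloisGroup (p : ℕ) [Fact p.Prime] (K : Type) [Field K]
    [Algebra ℚ_[p] K] [FiniteDimensional ℚ_[p] K]
    (U : Subgroup (absoluteGaloisGroup K)) (hU : IsOpen (U : Set (absoluteGaloisGroup K))) :
    freeProlRank U p = ((Module.finrank ℚ_[p] K * U.index + 1 : ℕ) : ℕ∞) := by
  haveI : CharZero K := charZero_of_injective_algebraMap (algebraMap ℚ_[p] K).injective
  obtain ⟨L, hLfin, -, hLU⟩ := exists_intermediateField_of_isOpen_absoluteGaloisGroup K U hU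
  haveI := hLfin
  haveI : FiniteDimensional ℚ_[p] L := Module.Finite.trans K L
  have hidx : U.index = Module.finrank K L := by
    haveI : IsGalois K (AlgebraicClosure K) := {}
    rw [IntermediateField.finrank_eq_fixingSubgroup_index, ← hLU,
      Subgroup.index_comap_of_surjective _ (absoluteGaloisGroup.toAlgEquiv K).surjective]
  obtain ⟨e⟩ := nonempty_continuousMulEquiv_fixingSubgroup K L
  rw [hLU] at e
  rw [freeProlRank_eq_of_continuousMulEquiv e p, (thm26_ii_delta_gal_holds p L).2, hidx,
    Module.finrank_mul_finrank]

/-! ### `G_K` is elastic -/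

/-- **[AbsTopI] Thm 1.7 (ii) (typed predicate, independent route): for `K` a finite extension of
`ℚ_p`, the absolute Galois group `G_K` is ELASTIC** — every topologically finitely generated closed
normal subgroup of an open subgroup of `G_K` is trivial or of finite index.  Proof: the elasticity
criterion `isElastic_of_freeProlRank_open_eq` (linear rank formula `δ¹_p(U) = [K:ℚ_p]·[G_K:U] + 1`
on open subgroups) with the key rank lemma `freeProlRank_le_add_of_sup_zpowers`.  GAP-LEDGER row
G-w5d206-1. [cite: MochizukiAbsTopI2012, Thm 1.7 (ii) p.14] -/
theorem isElastic_absoluteGaloisGroup (p : ℕ) [Fact p.Prime] (K : Type) [Field K]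
    [Algebra ℚ_[p] K] [FiniteDimensional ℚ_[p] K] : IsElastic (absoluteGaloisGroup K) := by
  haveI : CharZero K := charZero_of_injective_algebraMap (algebraMap ℚ_[p] K).injective
  exact isElastic_of_freeProlRank_open_eq_of_isClosed p (Module.finrank ℚ_[p] K) Module.finrank_pos
    (fun U hU => freeProlRank_eq_of_isOpen_absoluteGaloisGroup p K U hU)
    (fun V V' M σ hV'o hV'V hMV' hσV hgen hV'n hcomm hMc =>
      freeProlRank_le_add_of_sup_zpowers p V V' M σ hV'o hV'V hMV' hσV hgen hV'n hcomm hMc)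

/-! ### Elasticity is an isomorphism invariant -/

section Transport

variable {G : Type u} [Group G] [TopologicalSpace G] [IsTopologicalGroup G]
variable {H : Type v} [Group H] [TopologicalSpace H] [IsTopologicalGroup H]

/-- Elasticity ([AbsTopI] Def 1.1 (ii)) is transported along isomorphisms of topological groups.
[cite: MochizukiAbsTopI2012, Def 1.1 (ii) p.10] -/
theorem IsElastic.of_continuousMulEquiv (e : G ≃ₜ* H) (hH : IsElastic H) : IsElastic G := by
  refine ⟨fun U N hUo hNU hNn hNc hNfg => ?_⟩
  -- images in `H`
  let U' : Subgroup H := U.map e.toMonoidHom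
  let N' : Subgroup H := N.map e.toMonoidHom
  have himg : ∀ (S : Subgroup G), ((S.map e.toMonoidHom : Subgroup H) : Set H) = e '' (S : Set G) :=
    fun S => Subgroup.coe_map _ _
  have hU'o : IsOpen (U' : Set H) := by
    rw [himg]; exact e.toHomeomorph.isOpenMap _ hUo
  have hN'c : IsClosed (N' : Set H) := by
    rw [himg]; exact e.toHomeomorph.isClosedMap _ hNc
  have hN'U' : N' ≤ U' := Subgroup.map_mono hNU
  have hmemN' : ∀ x, x ∈ N' ↔ e.symm x ∈ N := by
    intro x
    constructor
    · rintro ⟨y, hy, rfl⟩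
      change e.symm (e y) ∈ N
      rw [e.symm_apply_apply]
      exact hy
    · intro hx
      exact ⟨e.symm x, hx, e.apply_symm_apply x⟩
  have hmemU' : ∀ x, x ∈ U' ↔ e.symm x ∈ U := by
    intro x
    constructor
    · rintro ⟨y, hy, rfl⟩
      change e.symm (e y) ∈ U
      rw [e.symm_apply_apply]
      exact hy
    · intro hx
      exact ⟨e.symm x, hx, e.apply_symm_apply x⟩
  have hN'n : (N'.subgroupOf U').Normal := by
    refine ⟨fun n hn g => ?_⟩
    rw [Subgroup.mem_subgroupOf] at hn ⊢
    have hg : e.symm (g : H) ∈ U := (hmemU' _).mp g.2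
    have hn' : e.symm (n : H) ∈ N := (hmemN' _).mp hn
    have h1 := hNn.conj_mem ⟨e.symm (n : H), hNU hn'⟩
      (by rw [Subgroup.mem_subgroupOf]; exact hn') ⟨e.symm (g : H), hg⟩
    rw [Subgroup.mem_subgroupOf] at h1
    rw [hmemN']
    simpa using h1
  -- `N ≅ N'` as topological groups, so `N'` is topologically finitely generated
  let f : N →ₜ* N' :=
    { toFun := fun n => ⟨e n, ⟨n, n.2, rfl⟩⟩
      map_one' := Subtype.ext (by simp)
      map_mul' := fun a b => Subtype.ext (by simp)
      continuous_toFun := (e.continuous.comp continuous_subtype_val).subtype_mk _ }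
  have hf : Function.Surjective f := by
    rintro ⟨x, hx⟩
    exact ⟨⟨e.symm x, (hmemN' x).mp hx⟩, Subtype.ext (e.apply_symm_apply x)⟩
  have hN'fg : IsTopologicallyFinitelyGenerated N' :=
    IsTopologicallyFinitelyGenerated.of_surjective f hf hNfg
  -- conclude in `H` and pull back
  rcases hH.eq_bot_or_finiteIndex U' N' hU'o hN'U' hN'n hN'c hN'fg with h | h
  · left
    rw [eq_bot_iff]
    intro n hn
    have hn' : e n ∈ N' := ⟨n, hn, rfl⟩
    rw [h, Subgroup.mem_bot] at hn'
    exact Subgroup.mem_bot.mpr ((map_eq_one_iff e e.injective).mp hn')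
  · right
    have hidx : N'.index = N.index :=
      Subgroup.index_map_of_bijective e.bijective N
    exact ⟨by rw [← hidx]; exact h.index_ne_zero⟩

end Transport

/-! ### [AbsTopI] Thm 2.6 (iv) for extensions with MLF base, elasticity discharged -/

namespace FundamentalExtension

variable {E : FundamentalExtension.{0}}

/-- For an abstract extension `1 → Δ → Π → G → 1` with MLF base data `G ≅ G_K` (`K/ℚ_p` finite),
`G` is elastic ([AbsTopI] Thm 1.7 (ii), transported along `galIso`).
[cite: MochizukiAbsTopI2012, Thm 1.7 (ii) p.14] -/
theorem MLFBase.isElastic_gal (B : E.MLFBase) : IsElastic E.gal := by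
  letI := B.instPrime
  exact IsElastic.of_continuousMulEquiv B.galIso (isElastic_absoluteGaloisGroup B.p B.K)

/-- **[AbsTopI] Thm 2.6 (iv)** (typed `E.Thm26iv Σ`) for EVERY abstract extension with MLF base
data, given only the topological finite generation of `Δ` ([AbsTopI] Prop 2.2, BY NAME:
`E.GeomTFG`) and the construction datum "`Δ` is pro-`Σ`" with `Σ ⊆ Primes`; the elasticity of `G`
(Thm 1.7 (ii)) is now a theorem (`MLFBase.isElastic_gal`).  abc-iut-w5-d206's
`thm26iv_of_isElastic_gal` made unconditional in its elasticity input.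
[cite: MochizukiAbsTopI2012, Thm 2.6 (iv) p.22] -/
theorem MLFBase.thm26iv (B : E.MLFBase) (hΔ : E.GeomTFG) {S : Set ℕ} (hS : S ⊆ {q | q.Prime})
    (hΔS : IsProSet E.geom S) : E.Thm26iv S :=
  thm26iv_of_isElastic_gal B B.isElastic_gal hΔ hS hΔS

/-- **"`Δ ⊆ Π` may be characterized group-theoretically"** ([AbsTopI] Thm 2.6 (iv), case
`Σ ≠ Primes`): for two extensions with MLF base data, `Δ` topologically finitely generated
(Prop 2.2 BY NAME) and `Σ_E, Σ_F ⊊ Primes`, every isomorphism `φ : Π_E ⥲ Π_F` carries `Δ_E` onto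
`Δ_F` — elasticity input discharged. [cite: MochizukiAbsTopI2012, Thm 2.6 (iv) p.22] -/
theorem MLFBase.preservesGeom {E F : FundamentalExtension.{0}} (BE : E.MLFBase) (BF : F.MLFBase)
    (hΔE : E.GeomTFG) (hΔF : F.GeomTFG) {S T : Set ℕ} (hS : S ⊆ {q | q.Prime})
    (hS' : S ≠ {q | q.Prime}) (hES : IsProSet E.geom S) (hT : T ⊆ {q | q.Prime})
    (hT' : T ≠ {q | q.Prime}) (hFT : IsProSet F.geom T) (φ : E.arith ≃ₜ* F.arith) :
    PreservesGeom φ :=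
  MLFBase.preservesGeom_of_isElastic_gal BE BF BE.isElastic_gal BF.isElastic_gal hΔE hΔF hS hS'
    hES hT hT' hFT φ

end FundamentalExtension

end Literature.AnabelianGeometry.AbsoluteAnabelian

end
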